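import Mathlib.NumberTheory.Padics.Hensel
import Mathlib.NumberTheory.Padics.PadicVal.Basic
import Mathlib.Tactic.LinearCombination
import Mathlib.Tactic.Ring
import Mathlib.Tactic.FieldSimp
import Mathlib.Tactic.Push
import Literature.NumberTheory.QuadraticFields.Sqrt73Places
import HarnessLib

/-!
# The `3`-adic Newton polygon of `Ψ₃ = 3x⁴ + 6Ax² + 12Bx − A²`: roots in `ℚ₃` iff
# `A = 0` or `2·v₃(B) + 2 ≤ 3·v₃(A)` (cell `b2b-bsdres`, harvest seat 2, GEN 42, note E89; theorems only)

HONEST FRAMING (cell `b2b-bsdres`, run/shared/lean/b2b/bsd-rank1-residual/, verbatim in every file): the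
goal of the cell is to DELETE the COMBINATION-SHAPED residual classes of the Birch–Swinnerton-Dyer formula
for ALL analytic-rank `≤ 1` elliptic curves over `ℚ` — "full BSD formula for every rank `≤ 1` curve in
class `C`" assembled STRICTLY from published theorems — so that the rank-`≤ 1` remainder becomes exactly
the CONSTRUCTION-SHAPED classes, which are TYPED (missing-input `Prop`s), NOT attempted. This is not
"finishing BSD". This file: THEOREMS ONLY (no definition, no named fact, no `@[conjecture]` node; net
named-fact debt `0`), pure `3`-adic analysis with no elliptic curve in it; nothing about any curve is
asserted; nothing is booked; no mark of `RESIDUAL-MAP.md` moves.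

## What is proved (the arithmetic kernel of L-O56-sel `Additive.LocIrrThreeIffCriterion`)

For `A, B ∈ ℚ` let `f(x) = 3x⁴ + 6Ax² + 12Bx − A²` — the `3`-division polynomial `Ψ₃` of the short
Weierstrass model `y² = x³ + Ax + B` (Cremona 1997 §3.8: "the 3-division polynomial `3x⁴+6ax²+12bx−a²`").
Its `3`-adic Newton polygon has the vertices `(4, 1), (2, 1 + v₃A), (1, 1 + v₃B), (0, 2v₃A)` (module
docstring of `Additive/LocIrrValuationCriterionThree.lean`, there in the coordinates `A = −27c₄, B = −54c₆`).

* `psi3_ne_zero_of_criterion` — **no root**: if `A ≠ 0` and (`B = 0` or `3·v₃(A) ≤ 2·v₃(B) + 1`) then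
  `f` has no root in `ℚ₃`. Proof: at a root `x ≠ 0` of valuation `ν` the four (three) non-zero summands
  `3x⁴, 6Ax², 12Bx, −A²` have valuations `1 + 4ν, 1 + v₃A + 2ν, 1 + v₃B + ν, 2v₃A`; in a vanishing sum no
  summand has valuation strictly below all the others (ultrametric inequality,
  `not_lt_of_add_four_eq_zero`), and under the hypothesis one of them always does (linear arithmetic over
  `ℤ`, `omega`; the polygon is a single segment of slope `(2v₃A − 1)/4 ∉ ℤ`).
* `psi3_exists_root_of_lt` — **a root**: if `A ≠ 0`, `B ≠ 0` and `2·v₃(B) + 2 ≤ 3·v₃(A)` then `f` has a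
  root in `ℚ₃`. Proof: with `ν = 2v₃A − v₃B − 1`, `u = 3^ν`, `w = 3^{v₃A}`, the rescaled
  `g(y) = w⁻² f(uy) = g₄y⁴ + g₂y² + g₁y + g₀` has `v₃(g₄), v₃(g₂) ≥ 1` and `v₃(g₁) = v₃(g₀) = 0`, so
  `g ∈ ℤ₃[y]`, `a₀ = −g₀/g₁` has `‖g(a₀)‖ < 1 = ‖g′(a₀)‖²`, and Mathlib's `hensels_lemma` gives a root
  `z ∈ ℤ₃` of `g`, whence the root `uz` of `f` (the length-one first segment of the polygon).
* `psi3_exists_root_iff` — the two halves together: for `A ≠ 0`, `f` has a root in `ℚ₃` iff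
  `B ≠ 0 ∧ 2·v₃(B) + 2 ≤ 3·v₃(A)`; and `psi3_zero_isRoot_of_eq_zero` (`A = 0`: the root `x = 0`).

Consumed by `Additive/LocIrrValuationCriterionThreeProofs.lean` (L-O56-sel PROVED). References: J. Neukirch,
*Algebraic Number Theory* II §6 (Newton polygon) [folklore]; J. E. Cremona, *Algorithms for Modular Elliptic
Curves* (1997) §3.8 [Cremona1997]; Mathlib `Mathlib.NumberTheory.Padics.Hensel`.
-/

set_option autoImplicit false

noncomputable section

namespace Summit.BirchSwinnertonDyer.Rank1Residual.Additive.PsiThreeAdic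

open Padic Polynomial Literature.NumberTheory.QuadraticFields

/-! ## §1 `p`-adic bookkeeping (`v(−x) = v(x)` and `v₃(3) = 1` are the tree's
`Sqrt41.valuation_neg''`, `Sqrt73.valuation_three'`) -/

/-- Ultrametric inequality for three summands (`Padic.valuation 0 = 0` is harmless here). [folklore] -/
theorem min_valuation_le_of_add_add_ne_zero {p : ℕ} [Fact p.Prime] {y z w : ℚ_[p]}
    (h : y + z + w ≠ 0) :
    min (min y.valuation z.valuation) w.valuation ≤ (y + z + w).valuation := by
  by_cases hyz : y + z = 0
  · rw [hyz, zero_add]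
    exact min_le_right _ _
  · exact le_trans (min_le_min (Padic.le_valuation_add hyz) le_rfl) (Padic.le_valuation_add h)

/-- In a vanishing sum of three `p`-adic numbers a NON-ZERO summand never has valuation strictly below
the other two. [folklore] -/
theorem not_lt_of_add_three_eq_zero {p : ℕ} [Fact p.Prime] {s t u : ℚ_[p]} (hs : s ≠ 0)
    (h : s + t + u = 0) : ¬ (s.valuation < t.valuation ∧ s.valuation < u.valuation) := by
  rintro ⟨h1, h2⟩
  have hs' : s = -(t + u) := by linear_combination h
  have htu : t + u ≠ 0 := by
    intro h0
    apply hs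
    rw [hs', h0, neg_zero]
  have hv : s.valuation = (t + u).valuation := by rw [hs', Sqrt41.valuation_neg'']
  have := Padic.le_valuation_add htu
  rw [← hv] at this
  rcases min_le_iff.mp this with h' | h'
  · exact absurd h1 (not_lt.mpr h')
  · exact absurd h2 (not_lt.mpr h')

/-- In a vanishing sum of four `p`-adic numbers a NON-ZERO summand never has valuation strictly below
the other three. [folklore] -/
theorem not_lt_of_add_four_eq_zero {p : ℕ} [Fact p.Prime] {s t u w : ℚ_[p]} (hs : s ≠ 0)
    (h : s + t + u + w = 0) :
    ¬ (s.valuation < t.valuation ∧ s.valuation < u.valuation ∧ s.valuation < w.valuation) := by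
  rintro ⟨h1, h2, h3⟩
  have hs' : s = -(t + u + w) := by linear_combination h
  have htuw : t + u + w ≠ 0 := by
    intro h0
    apply hs
    rw [hs', h0, neg_zero]
  have hv : s.valuation = (t + u + w).valuation := by rw [hs', Sqrt41.valuation_neg'']
  have := min_valuation_le_of_add_add_ne_zero htuw
  rw [← hv] at this
  rcases min_le_iff.mp this with h' | h'
  · rcases min_le_iff.mp h' with h'' | h''
    · exact absurd h1 (not_lt.mpr h'')
    · exact absurd h2 (not_lt.mpr h'')
  · exact absurd h3 (not_lt.mpr h')

/-- `‖x‖ < 1` for a non-zero `p`-adic number of positive valuation. [folklore] -/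
theorem norm_lt_one_of_valuation_pos {p : ℕ} [Fact p.Prime] {x : ℚ_[p]} (hx : x ≠ 0)
    (hv : 0 < x.valuation) : ‖x‖ < 1 := by
  rw [Padic.norm_eq_zpow_neg_valuation hx]
  exact zpow_lt_one_of_neg₀ (by exact_mod_cast (Fact.out : p.Prime).one_lt) (by omega)

/-- `‖x‖ = 1` for a non-zero `p`-adic number of valuation `0`. [folklore] -/
theorem norm_eq_one_of_valuation_eq_zero {p : ℕ} [Fact p.Prime] {x : ℚ_[p]} (hx : x ≠ 0)
    (hv : x.valuation = 0) : ‖x‖ = 1 := by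
  rw [Padic.norm_eq_zpow_neg_valuation hx, hv, neg_zero, zpow_zero]

/-- `v₃(6) = 1`. [folklore] -/
theorem valuation_six : (6 : ℚ_[3]).valuation = 1 := by
  have : (6 : ℚ_[3]) = ((3 : ℕ) : ℚ_[3]) * ((2 : ℕ) : ℚ_[3]) := by norm_num
  rw [this, Padic.valuation_mul (by norm_num) (by norm_num), Padic.valuation_natCast,
    Padic.valuation_natCast]
  simp [padicValNat.eq_zero_of_not_dvd (show ¬ 3 ∣ 2 by norm_num)]

/-- `v₃(12) = 1`. [folklore] -/
theorem valuation_twelve : (12 : ℚ_[3]).valuation = 1 := by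
  have : (12 : ℚ_[3]) = ((3 : ℕ) : ℚ_[3]) * ((4 : ℕ) : ℚ_[3]) := by norm_num
  rw [this, Padic.valuation_mul (by norm_num) (by norm_num), Padic.valuation_natCast,
    Padic.valuation_natCast]
  simp [padicValNat.eq_zero_of_not_dvd (show ¬ 3 ∣ 4 by norm_num)]

/-! ## §2 The no-root half (single-segment Newton polygon) -/

/-- **No root of `Ψ₃` in `ℚ₃` under the criterion.** For `A, B ∈ ℚ`, `A ≠ 0`, with `B = 0` or
`3·v₃(A) ≤ 2·v₃(B) + 1`, the quartic `3x⁴ + 6Ax² + 12Bx − A²` has no root in `ℚ₃`: all its roots have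
valuation `(2v₃A − 1)/4 ∉ ℤ`. [folklore] -/
theorem psi3_ne_zero_of_criterion {A B : ℚ} (hA : A ≠ 0)
    (hcrit : B = 0 ∨ 3 * padicValRat 3 A ≤ 2 * padicValRat 3 B + 1) (x : ℚ_[3]) :
    3 * x ^ 4 + 6 * (A : ℚ_[3]) * x ^ 2 + 12 * (B : ℚ_[3]) * x - (A : ℚ_[3]) ^ 2 ≠ 0 := by
  intro hx
  have hA' : (A : ℚ_[3]) ≠ 0 := by exact_mod_cast hA
  have hx0 : x ≠ 0 := by
    rintro rfl
    simp only [ne_eq, zero_pow, OfNat.ofNat_ne_zero, not_false_eq_true, mul_zero, add_zero,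
      zero_sub, neg_eq_zero, pow_eq_zero_iff] at hx
    exact hA' hx
  set ν := x.valuation with hν
  have h3ne : (3 : ℚ_[3]) ≠ 0 := by norm_num
  have h6ne : (6 : ℚ_[3]) ≠ 0 := by norm_num
  have h12ne : (12 : ℚ_[3]) ≠ 0 := by norm_num
  have hvA : (A : ℚ_[3]).valuation = padicValRat 3 A := Padic.valuation_ratCast A
  have hvB : (B : ℚ_[3]).valuation = padicValRat 3 B := Padic.valuation_ratCast B
  have ht4 : (3 * x ^ 4 : ℚ_[3]).valuation = 1 + 4 * ν := by
    rw [Padic.valuation_mul h3ne (pow_ne_zero 4 hx0), Sqrt73.valuation_three', Padic.valuation_pow]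
    push_cast; ring
  have ht2 : (6 * (A : ℚ_[3]) * x ^ 2).valuation = 1 + padicValRat 3 A + 2 * ν := by
    rw [Padic.valuation_mul (mul_ne_zero h6ne hA') (pow_ne_zero 2 hx0),
      Padic.valuation_mul h6ne hA', valuation_six, hvA, Padic.valuation_pow]
    push_cast; ring
  have ht0 : (-(A : ℚ_[3]) ^ 2).valuation = 2 * padicValRat 3 A := by
    rw [Sqrt41.valuation_neg'', Padic.valuation_pow, hvA]; push_cast; ring
  have ht4ne : (3 * x ^ 4 : ℚ_[3]) ≠ 0 := mul_ne_zero h3ne (pow_ne_zero 4 hx0)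
  have ht2ne : (6 * (A : ℚ_[3]) * x ^ 2) ≠ 0 := mul_ne_zero (mul_ne_zero h6ne hA') (pow_ne_zero 2 hx0)
  have ht0ne : (-(A : ℚ_[3]) ^ 2) ≠ 0 := neg_ne_zero.mpr (pow_ne_zero 2 hA')
  rcases eq_or_ne B 0 with hB | hB
  · -- three summands
    subst hB
    have hsum : 3 * x ^ 4 + 6 * (A : ℚ_[3]) * x ^ 2 + (-(A : ℚ_[3]) ^ 2) = 0 := by
      rw [← hx]; push_cast; ring
    have k4 := not_lt_of_add_three_eq_zero ht4ne hsum
    have k2 := not_lt_of_add_three_eq_zero ht2ne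
      (show 6 * (A : ℚ_[3]) * x ^ 2 + 3 * x ^ 4 + (-(A : ℚ_[3]) ^ 2) = 0 by rw [← hsum]; ring)
    have k0 := not_lt_of_add_three_eq_zero ht0ne
      (show (-(A : ℚ_[3]) ^ 2) + 3 * x ^ 4 + 6 * (A : ℚ_[3]) * x ^ 2 = 0 by rw [← hsum]; ring)
    rw [ht4, ht2, ht0] at k4 k2 k0
    omega
  · -- four summands
    have hB' : (B : ℚ_[3]) ≠ 0 := by exact_mod_cast hB
    have hle : 3 * padicValRat 3 A ≤ 2 * padicValRat 3 B + 1 := by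
      rcases hcrit with h | h
      · exact absurd h hB
      · exact h
    have ht1 : (12 * (B : ℚ_[3]) * x).valuation = 1 + padicValRat 3 B + ν := by
      rw [Padic.valuation_mul (mul_ne_zero h12ne hB') hx0, Padic.valuation_mul h12ne hB',
        valuation_twelve, hvB]
    have ht1ne : (12 * (B : ℚ_[3]) * x) ≠ 0 := mul_ne_zero (mul_ne_zero h12ne hB') hx0
    have hsum :
        3 * x ^ 4 + 6 * (A : ℚ_[3]) * x ^ 2 + 12 * (B : ℚ_[3]) * x + (-(A : ℚ_[3]) ^ 2) = 0 := by
      rw [← hx]; ring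
    have k4 := not_lt_of_add_four_eq_zero ht4ne hsum
    have k2 := not_lt_of_add_four_eq_zero ht2ne
      (show 6 * (A : ℚ_[3]) * x ^ 2 + 3 * x ^ 4 + 12 * (B : ℚ_[3]) * x + (-(A : ℚ_[3]) ^ 2) = 0 by
        rw [← hsum]; ring)
    have k1 := not_lt_of_add_four_eq_zero ht1ne
      (show 12 * (B : ℚ_[3]) * x + 3 * x ^ 4 + 6 * (A : ℚ_[3]) * x ^ 2 + (-(A : ℚ_[3]) ^ 2) = 0 by
        rw [← hsum]; ring)
    have k0 := not_lt_of_add_four_eq_zero ht0ne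
      (show (-(A : ℚ_[3]) ^ 2) + 3 * x ^ 4 + 6 * (A : ℚ_[3]) * x ^ 2 + 12 * (B : ℚ_[3]) * x = 0 by
        rw [← hsum]; ring)
    rw [ht4, ht2, ht1, ht0] at k4 k2 k1 k0
    omega

/-! ## §3 The root half (a length-one first segment; Hensel's lemma in `ℤ₃`) -/

/-- **A root of `Ψ₃` in `ℚ₃` off the criterion.** For `A, B ∈ ℚ` non-zero with
`2·v₃(B) + 2 ≤ 3·v₃(A)` the quartic `3x⁴ + 6Ax² + 12Bx − A²` has a root in `ℚ₃` (of valuation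
`2v₃(A) − v₃(B) − 1`), by Hensel's lemma applied to `w⁻² f(u y)`, `u = 3^{2v₃A − v₃B − 1}`, `w = 3^{v₃A}`,
at `a₀ = A²/(12Bu)`. [folklore] -/
theorem psi3_exists_root_of_lt {A B : ℚ} (hA : A ≠ 0) (hB : B ≠ 0)
    (hlt : 2 * padicValRat 3 B + 2 ≤ 3 * padicValRat 3 A) :
    ∃ x : ℚ_[3], 3 * x ^ 4 + 6 * (A : ℚ_[3]) * x ^ 2 + 12 * (B : ℚ_[3]) * x - (A : ℚ_[3]) ^ 2 = 0 := by
  set a : ℤ := padicValRat 3 A with ha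
  set b : ℤ := padicValRat 3 B with hb
  set ν : ℤ := 2 * a - b - 1 with hν
  have hA' : (A : ℚ_[3]) ≠ 0 := by exact_mod_cast hA
  have hB' : (B : ℚ_[3]) ≠ 0 := by exact_mod_cast hB
  have hπ : (3 : ℚ_[3]) ≠ 0 := by norm_num
  have hvA : (A : ℚ_[3]).valuation = a := Padic.valuation_ratCast A
  have hvB : (B : ℚ_[3]).valuation = b := Padic.valuation_ratCast B
  -- `u = 3^ν`, `w = 3^a`
  set u : ℚ_[3] := (3 : ℚ_[3]) ^ ν with hu
  set w : ℚ_[3] := (3 : ℚ_[3]) ^ a with hw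
  have hu0 : u ≠ 0 := zpow_ne_zero ν hπ
  have hw0 : w ≠ 0 := zpow_ne_zero a hπ
  have hvu : u.valuation = ν := by rw [hu, Padic.valuation_zpow, Sqrt73.valuation_three', mul_one]
  have hvw : w.valuation = a := by rw [hw, Padic.valuation_zpow, Sqrt73.valuation_three', mul_one]
  have hvw2 : (w ^ 2)⁻¹.valuation = -(2 * a) := by
    rw [Padic.valuation_inv, Padic.valuation_pow, hvw]; push_cast; ring
  have hw2 : (w ^ 2)⁻¹ ≠ 0 := inv_ne_zero (pow_ne_zero 2 hw0)
  -- the rescaled coefficients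
  set g4 : ℚ_[3] := 3 * u ^ 4 * (w ^ 2)⁻¹ with hg4
  set g2 : ℚ_[3] := 6 * (A : ℚ_[3]) * u ^ 2 * (w ^ 2)⁻¹ with hg2
  set g1 : ℚ_[3] := 12 * (B : ℚ_[3]) * u * (w ^ 2)⁻¹ with hg1
  set g0 : ℚ_[3] := -((A : ℚ_[3]) ^ 2 * (w ^ 2)⁻¹) with hg0
  have h3ne : (3 : ℚ_[3]) ≠ 0 := by norm_num
  have h6ne : (6 : ℚ_[3]) ≠ 0 := by norm_num
  have h12ne : (12 : ℚ_[3]) ≠ 0 := by norm_num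
  have hg4ne : g4 ≠ 0 := mul_ne_zero (mul_ne_zero h3ne (pow_ne_zero 4 hu0)) hw2
  have hg2ne : g2 ≠ 0 := mul_ne_zero (mul_ne_zero (mul_ne_zero h6ne hA') (pow_ne_zero 2 hu0)) hw2
  have hg1ne : g1 ≠ 0 := mul_ne_zero (mul_ne_zero (mul_ne_zero h12ne hB') hu0) hw2
  have hg0ne : g0 ≠ 0 := neg_ne_zero.mpr (mul_ne_zero (pow_ne_zero 2 hA') hw2)
  have hg4v : g4.valuation = 1 + 4 * ν - 2 * a := by
    rw [hg4, Padic.valuation_mul (mul_ne_zero h3ne (pow_ne_zero 4 hu0)) hw2,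
      Padic.valuation_mul h3ne (pow_ne_zero 4 hu0), Sqrt73.valuation_three', Padic.valuation_pow, hvu, hvw2]
    push_cast; ring
  have hg2v : g2.valuation = 1 + a + 2 * ν - 2 * a := by
    rw [hg2, Padic.valuation_mul (mul_ne_zero (mul_ne_zero h6ne hA') (pow_ne_zero 2 hu0)) hw2,
      Padic.valuation_mul (mul_ne_zero h6ne hA') (pow_ne_zero 2 hu0), Padic.valuation_mul h6ne hA',
      valuation_six, hvA, Padic.valuation_pow, hvu, hvw2]
    push_cast; ring
  have hg1v : g1.valuation = 0 := by
    rw [hg1, Padic.valuation_mul (mul_ne_zero (mul_ne_zero h12ne hB') hu0) hw2,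
      Padic.valuation_mul (mul_ne_zero h12ne hB') hu0, Padic.valuation_mul h12ne hB',
      valuation_twelve, hvB, hvu, hvw2, hν]
    ring
  have hg0v : g0.valuation = 0 := by
    rw [hg0, Sqrt41.valuation_neg'', Padic.valuation_mul (pow_ne_zero 2 hA') hw2, Padic.valuation_pow, hvA,
      hvw2]
    push_cast; ring
  -- norms, and the lift to `ℤ₃`
  have hn4 : ‖g4‖ < 1 := norm_lt_one_of_valuation_pos hg4ne (by rw [hg4v]; omega)
  have hn2 : ‖g2‖ < 1 := norm_lt_one_of_valuation_pos hg2ne (by rw [hg2v]; omega)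
  have hn1 : ‖g1‖ = 1 := norm_eq_one_of_valuation_eq_zero hg1ne hg1v
  have hn0 : ‖g0‖ = 1 := norm_eq_one_of_valuation_eq_zero hg0ne hg0v
  set G4 : ℤ_[3] := ⟨g4, hn4.le⟩ with hG4
  set G2 : ℤ_[3] := ⟨g2, hn2.le⟩ with hG2
  set G1 : ℤ_[3] := ⟨g1, hn1.le⟩ with hG1
  set G0 : ℤ_[3] := ⟨g0, hn0.le⟩ with hG0
  have hN4 : ‖G4‖ < 1 := hn4
  have hN2 : ‖G2‖ < 1 := hn2
  have hN1 : ‖G1‖ = 1 := hn1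
  have hU1 : IsUnit G1 := PadicInt.isUnit_iff.mpr hN1
  -- the integral polynomial and the approximate root `a₀ = −g₀/g₁`
  set G : Polynomial ℤ_[3] := C G4 * X ^ 4 + C G2 * X ^ 2 + C G1 * X + C G0 with hG
  set a₀ : ℤ_[3] := -G0 * ↑(hU1.unit⁻¹) with ha₀
  have hinv : G1 * ↑(hU1.unit⁻¹) = 1 := hU1.mul_val_inv
  have hGeval : ∀ t : ℤ_[3], G.aeval t = G4 * t ^ 4 + G2 * t ^ 2 + G1 * t + G0 := by
    intro t
    rw [hG, Polynomial.coe_aeval_eq_eval]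
    simp only [eval_add, eval_mul, eval_C, eval_pow, eval_X]
  have hGderiv : ∀ t : ℤ_[3], G.derivative.aeval t = 4 * G4 * t ^ 3 + 2 * G2 * t + G1 := by
    intro t
    rw [hG, Polynomial.coe_aeval_eq_eval]
    simp only [derivative_add, derivative_mul, derivative_C, derivative_X_pow, derivative_X,
      zero_mul, zero_add, mul_one, eval_add, eval_mul, eval_C, eval_pow, eval_X, Nat.cast_ofNat,
      add_zero]
    ring
  have hlin : G1 * a₀ + G0 = 0 := by
    rw [ha₀]
    linear_combination (-G0) * hinv
  have hGa : G.aeval a₀ = G4 * a₀ ^ 4 + G2 * a₀ ^ 2 := by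
    rw [hGeval]; linear_combination hlin
  -- `‖G(a₀)‖ < 1 = ‖G′(a₀)‖²`
  have hsmall : ‖G.aeval a₀‖ < 1 := by
    rw [hGa]
    refine lt_of_le_of_lt (PadicInt.nonarchimedean _ _) (max_lt ?_ ?_)
    · rw [norm_mul]
      exact lt_of_le_of_lt (mul_le_of_le_one_right (norm_nonneg _) (PadicInt.norm_le_one _)) hN4
    · rw [norm_mul]
      exact lt_of_le_of_lt (mul_le_of_le_one_right (norm_nonneg _) (PadicInt.norm_le_one _)) hN2
  have hderiv : ‖G.derivative.aeval a₀‖ = 1 := by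
    rw [hGderiv]
    have hs : ‖4 * G4 * a₀ ^ 3 + 2 * G2 * a₀‖ < 1 := by
      refine lt_of_le_of_lt (PadicInt.nonarchimedean _ _) (max_lt ?_ ?_)
      · rw [norm_mul, norm_mul]
        calc ‖(4 : ℤ_[3])‖ * ‖G4‖ * ‖a₀ ^ 3‖ ≤ 1 * ‖G4‖ * 1 := by
              gcongr
              · exact PadicInt.norm_le_one _
              · exact PadicInt.norm_le_one _
          _ = ‖G4‖ := by ring
          _ < 1 := hN4
      · rw [norm_mul, norm_mul]
        calc ‖(2 : ℤ_[3])‖ * ‖G2‖ * ‖a₀‖ ≤ 1 * ‖G2‖ * 1 := by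
              gcongr
              · exact PadicInt.norm_le_one _
              · exact PadicInt.norm_le_one _
          _ = ‖G2‖ := by ring
          _ < 1 := hN2
    have hne : ‖4 * G4 * a₀ ^ 3 + 2 * G2 * a₀‖ ≠ ‖G1‖ := by rw [hN1]; exact hs.ne
    rw [PadicInt.norm_add_eq_max_of_ne hne, hN1, max_eq_right hs.le]
  have hnorm : ‖G.aeval a₀‖ < ‖G.derivative.aeval a₀‖ ^ 2 := by
    rw [hderiv, one_pow]; exact hsmall
  -- Hensel
  obtain ⟨z, hz, -⟩ := hensels_lemma hnorm
  refine ⟨u * (z : ℚ_[3]), ?_⟩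
  have hz' : g4 * (z : ℚ_[3]) ^ 4 + g2 * (z : ℚ_[3]) ^ 2 + g1 * (z : ℚ_[3]) + g0 = 0 := by
    have := congrArg (fun t : ℤ_[3] ↦ (t : ℚ_[3])) hz
    simp only [hGeval, PadicInt.coe_add, PadicInt.coe_mul, PadicInt.coe_pow,
      PadicInt.coe_zero] at this
    simpa [hG4, hG2, hG1, hG0] using this
  have key : 3 * (u * (z : ℚ_[3])) ^ 4 + 6 * (A : ℚ_[3]) * (u * (z : ℚ_[3])) ^ 2 +
      12 * (B : ℚ_[3]) * (u * (z : ℚ_[3])) - (A : ℚ_[3]) ^ 2 =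
      w ^ 2 * (g4 * (z : ℚ_[3]) ^ 4 + g2 * (z : ℚ_[3]) ^ 2 + g1 * (z : ℚ_[3]) + g0) := by
    rw [hg4, hg2, hg1, hg0]
    field_simp
    ring
  rw [key, hz', mul_zero]

/-! ## §4 Packaging -/

/-- `A = 0`: `x = 0` is a root (`Ψ₃ = 3x⁴ + 12Bx`; the `j = 0` curves). [folklore] -/
theorem psi3_zero_eq_zero_of_eq_zero (B : ℚ) :
    3 * (0 : ℚ_[3]) ^ 4 + 6 * ((0 : ℚ) : ℚ_[3]) * (0 : ℚ_[3]) ^ 2 + 12 * (B : ℚ_[3]) * 0 -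
      ((0 : ℚ) : ℚ_[3]) ^ 2 = 0 := by
  simp

/-- **The `3`-adic root criterion for `Ψ₃`.** For `A, B ∈ ℚ` with `A ≠ 0`:
`3x⁴ + 6Ax² + 12Bx − A²` has a root in `ℚ₃` iff `B ≠ 0` and `2·v₃(B) + 2 ≤ 3·v₃(A)`. [folklore] -/
theorem psi3_exists_root_iff {A B : ℚ} (hA : A ≠ 0) :
    (∃ x : ℚ_[3], 3 * x ^ 4 + 6 * (A : ℚ_[3]) * x ^ 2 + 12 * (B : ℚ_[3]) * x - (A : ℚ_[3]) ^ 2 = 0) ↔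
      B ≠ 0 ∧ 2 * padicValRat 3 B + 2 ≤ 3 * padicValRat 3 A := by
  constructor
  · rintro ⟨x, hx⟩
    by_contra hneg
    have hcrit : B = 0 ∨ 3 * padicValRat 3 A ≤ 2 * padicValRat 3 B + 1 := by
      by_cases hB : B = 0
      · exact Or.inl hB
      · right
        have : ¬ 2 * padicValRat 3 B + 2 ≤ 3 * padicValRat 3 A := fun h ↦ hneg ⟨hB, h⟩
        omega
    exact psi3_ne_zero_of_criterion hA hcrit x hx
  · rintro ⟨hB, hlt⟩
    exact psi3_exists_root_of_lt hA hB hlt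

end Summit.BirchSwinnertonDyer.Rank1Residual.Additive.PsiThreeAdic
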